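import Summits.QuantumFields.QCD.Theses.SpectralDefectExtinction
import Summits.QuantumFields.QCD.Theorems.SpectralDefectExtinctionWegnerEstimateStubCellAverageBound
import Summits.QuantumFields.QCD.Theorems.PauliWegnerSeaTiltedFlatnessStubBandLimit
import Summits.QuantumFields.QCD.Theorems.PauliWegnerSeaTiltedFlatnessStubActionLipschitz
import Summits.QuantumFields.QCD.Theorems.PauliWegnerSeaTiltedFlatnessStubEulerWord
import Summits.QuantumFields.QCD.Theorems.PauliWegnerSeaTiltedFlatnessStubCircleEngine
import Summits.QuantumFields.QCD.Theorems.PauliWegnerSeaTiltedFlatnessStubTorusSmallBalls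
import Summits.QuantumFields.QCD.Theorems.PauliWegnerSeaTiltedFlatnessStubHaarSmallBalls
import Literature.MeasureTheory.Integral.TiltedAnticoncentration
import Literature.MathematicalPhysics.QuantumFieldTheory.QCDPhaseQuenched
import Literature.MathematicalPhysics.QuantumFieldTheory.WilsonEnergyConvexity

/-!
# Stub T `stub_tiltedCellAverage` of line `determinant-tilt` (crux `ExtinctionBuildsQCD`,
item stmt-QuantumFields-18064): the TESTED, TILTED cell average

For every flavour number `N_f` and cell size `R` there are `C, p` such that for `β ≥ 1`, masses
`m_g ∈ [-2,2]`, tori `L ≥ max 4 (2R+3)`, every continuous `g ≥ 0` whose product-Haar means over the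
cell fibre (links based in `x + box 4 R` resampled, the rest frozen) are `≤ M` uniformly in the frozen
exterior, and every measurable `F ∈ [0,1]` blind to the cell links:
`⟨F·g⟩₊ ≤ C (1 + β^p) · M · ⟨F⟩₊`, `⟨·⟩₊ = qcdPhaseQuenchedExpect β L m`.

Proof (the phase-quenched analogue, with a test functional, of the landed quenched cell average
`WegnerEstimate.ResolventCell.stub_cellAverageBound`):
* `⟨φ⟩₊ = ∫ |det D| φ dμ_W / ∫ |det D| dμ_W` (`qcdPhaseQuenchedExpect_eq_div`) and
  `∫ ψ dμ_W = ∫ ψ e^{-βS} dHaar^⊗ / ∫ e^{-βS} dHaar^⊗` (`wilsonExpectation_eq_integral_div`), so it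
  suffices to compare the product-Haar integrals of `F g w` and `F w`, `w = |det D| e^{-βS}`;
* Fubini cell/exterior along the glueing map (`ResolventCell.stub_glueHaar`): the tested abstract
  engine `tilted_abstract` (the test functional is constant on every fibre and factors out);
* ON EVERY CELL FIBRE the sup-to-mean bound `w ≤ C_T (1+β)^{p_T} · (fibre Haar mean of w)`
  (`tilted_fibreDomination`): the squared sea `|det D|²` is a trigonometric polynomial of degree
  `≤ 48 N_f` along every one-link circle (`CircleTransport.stub_bandLimit`), so Nikolskii + weak Remez
  (`stub_circleEngine`, `stub_torusSmallBalls`, `stub_haarSmallBalls`, abstract in the listed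
  coordinates, here the `4(2R+1)^4` cell links) give relative Haar small balls; the Wilson action is
  Lipschitz along the circles (`stub_actionLipschitz`) so the ball-free untilt
  (`ResolventCell.stub_untilt` = `stub_eulerWord` + `stub_circleUntilt`) bounds the density
  `e^{-βS}/Z_fibre`; `Literature…flatness_and_smallBalls_of_anticoncentration` (a) assembles
  `|det D|(W₀) ≤ C' (∫ |det D| e^{-βS}) / (∫ e^{-βS})`, and one more untilt gives the claim;
* finally `(1+β)^p ≤ 2^p (1+β^p)` for `β ≥ 1`.
Sources: Wegner (1981) local averaging; Montvay–Münster §5.1 (phase-quenched weight); folklore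
measure theory.  No unproved named fact of the tree is used.
-/

noncomputable section

namespace Summit.QuantumFields.QCD.Cruxes.ExtinctionBuildsQCD.DeterminantTilt

open scoped BigOperators Topology Classical MeasureTheory Matrix ENNReal SchwartzMap
open Filter MeasureTheory Matrix
open Literature.MathematicalPhysics.QuantumLattice Literature.MathematicalPhysics.QuantumFieldTheory
  Literature.Probability.LatticeModels Literature.MathematicalPhysics.AQFT
open Summit.QuantumFields.QCD.Theorems
open Summit.QuantumFields.QCD.Cruxes.WegnerEstimate

/-- **Tested abstract engine.**  Let `π` be a probability measure on a compact metrisable space `X` and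
`gl : X → X → X` a continuous glueing with `(gl)_* (π ⊗ π) = π`.  If a continuous weight `w ≥ 0`
satisfies `w (gl U V) ≤ A ∫_V' w (gl U V') dπ`, the fibre averages of a continuous `g ≥ 0` are all
`≤ M`, and a measurable test functional `Φ ∈ [0,1]` is constant on fibres (`Φ (gl U V) = Φ U`), then
`∫ Φ g w dπ ≤ A M ∫ Φ w dπ`. -/
theorem tilted_abstract {X : Type*} [TopologicalSpace X] [CompactSpace X]
    [MeasurableSpace X] [BorelSpace X] [SecondCountableTopology X]
    (π : Measure X) [IsProbabilityMeasure π] (gl : X → X → X)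
    (hgl : Continuous fun p : X × X => gl p.1 p.2)
    (hmap : (π.prod π).map (fun p : X × X => gl p.1 p.2) = π) (w g Φ : X → ℝ) (hw : Continuous w)
    (hw0 : ∀ x, 0 ≤ w x) (hg : Continuous g) (hg0 : ∀ x, 0 ≤ g x) (hΦm : Measurable Φ)
    (hΦ01 : ∀ x, 0 ≤ Φ x ∧ Φ x ≤ 1) (hΦgl : ∀ U V, Φ (gl U V) = Φ U) {A M : ℝ} (hA : 0 ≤ A)
    (hdom : ∀ U V, w (gl U V) ≤ A * ∫ V', w (gl U V') ∂π)
    (hM : ∀ U, ∫ V, g (gl U V) ∂π ≤ M) :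
    ∫ x, Φ x * g x * w x ∂π ≤ A * M * ∫ x, Φ x * w x ∂π := by
  -- bounded measurable functions: iterated integrals along the glueing
  have key : ∀ G : X → ℝ, Measurable G → (∃ B, ∀ x, ‖G x‖ ≤ B) →
      Integrable (fun p : X × X => G (gl p.1 p.2)) (π.prod π) ∧
        ∫ x, G x ∂π = ∫ U, ∫ V, G (gl U V) ∂π ∂π := by
    intro G hG hB
    obtain ⟨B, hB⟩ := hB
    have hint : Integrable (fun p : X × X => G (gl p.1 p.2)) (π.prod π) :=
      Integrable.of_bound (hG.comp hgl.measurable).aestronglyMeasurable B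
        (Eventually.of_forall fun p => hB _)
    refine ⟨hint, ?_⟩
    calc ∫ x, G x ∂π = ∫ x, G x ∂((π.prod π).map fun p : X × X => gl p.1 p.2) := by rw [hmap]
      _ = ∫ p, G (gl p.1 p.2) ∂(π.prod π) :=
          integral_map hgl.measurable.aemeasurable hG.aestronglyMeasurable
      _ = ∫ U, ∫ V, G (gl U V) ∂π ∂π := integral_prod _ hint
  -- sup bounds of the continuous factors
  obtain ⟨Bg, hBg⟩ := isCompact_univ.exists_bound_of_continuousOn hg.continuousOn
  obtain ⟨Bw, hBw⟩ := isCompact_univ.exists_bound_of_continuousOn hw.continuousOn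
  have hΦn : ∀ x, ‖Φ x‖ ≤ 1 := fun x => by
    rw [Real.norm_eq_abs, abs_of_nonneg (hΦ01 x).1]; exact (hΦ01 x).2
  have hBg' : ∀ x, ‖g x‖ ≤ |Bg| := fun x => (hBg x (Set.mem_univ x)).trans (le_abs_self _)
  have hBw' : ∀ x, ‖w x‖ ≤ |Bw| := fun x => (hBw x (Set.mem_univ x)).trans (le_abs_self _)
  obtain ⟨hint₁, h₁⟩ := key (fun x => Φ x * g x * w x) ((hΦm.mul hg.measurable).mul hw.measurable)
    ⟨1 * |Bg| * |Bw|, fun x => by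
      rw [norm_mul, norm_mul]
      exact mul_le_mul (mul_le_mul (hΦn x) (hBg' x) (norm_nonneg _) zero_le_one)
        (hBw' x) (norm_nonneg _) (by positivity)⟩
  obtain ⟨hint₂, h₂⟩ := key (fun x => Φ x * w x) (hΦm.mul hw.measurable)
    ⟨1 * |Bw|, fun x => by
      rw [norm_mul]
      exact mul_le_mul (hΦn x) (hBw' x) (norm_nonneg _) zero_le_one⟩
  have hglU : ∀ U : X, Continuous fun V : X => gl U V := fun U =>
    hgl.comp (Continuous.prodMk_right U)
  -- the untested inner bound on each fibre
  have hinner₀ : ∀ U : X,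
      ∫ V, g (gl U V) * w (gl U V) ∂π ≤ A * M * ∫ V, w (gl U V) ∂π := by
    intro U
    have hZU0 : 0 ≤ ∫ V, w (gl U V) ∂π := integral_nonneg fun V => hw0 _
    calc ∫ V, g (gl U V) * w (gl U V) ∂π
        ≤ ∫ V, g (gl U V) * (A * ∫ V', w (gl U V') ∂π) ∂π := by
          refine integral_mono_of_nonneg (ae_of_all _ fun V => mul_nonneg (hg0 _) (hw0 _)) ?_
            (ae_of_all _ fun V => mul_le_mul_of_nonneg_left (hdom U V) (hg0 _))
          exact ((hg.comp (hglU U)).integrable_of_hasCompactSupport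
            (HasCompactSupport.of_compactSpace _)).mul_const _
      _ = (A * ∫ V', w (gl U V') ∂π) * ∫ V, g (gl U V) ∂π := by
          rw [integral_mul_const, mul_comm]
      _ ≤ (A * ∫ V', w (gl U V') ∂π) * M := mul_le_mul_of_nonneg_left (hM U) (mul_nonneg hA hZU0)
      _ = A * M * ∫ V, w (gl U V) ∂π := by ring
  -- the tested inner bound: the test functional factors out of the fibre integral
  have hinner : ∀ U : X,
      ∫ V, Φ (gl U V) * g (gl U V) * w (gl U V) ∂π ≤
        A * M * ∫ V, Φ (gl U V) * w (gl U V) ∂π := by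
    intro U
    simp_rw [hΦgl U, mul_assoc]
    rw [integral_const_mul, integral_const_mul]
    calc Φ U * ∫ V, g (gl U V) * w (gl U V) ∂π ≤ Φ U * (A * M * ∫ V, w (gl U V) ∂π) :=
          mul_le_mul_of_nonneg_left (hinner₀ U) (hΦ01 U).1
      _ = A * (M * (Φ U * ∫ V, w (gl U V) ∂π)) := by ring
  rw [h₁, h₂]
  calc ∫ U, ∫ V, Φ (gl U V) * g (gl U V) * w (gl U V) ∂π ∂π
      ≤ ∫ U, A * M * ∫ V, Φ (gl U V) * w (gl U V) ∂π ∂π :=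
        integral_mono hint₁.integral_prod_left (hint₂.integral_prod_left.const_mul _) hinner
    _ = A * M * ∫ U, ∫ V, Φ (gl U V) * w (gl U V) ∂π ∂π := integral_const_mul _ _

/-- **Fibrewise sup-to-mean bound for the tilted weight (cell tilted flatness).**  For every `N_f` and
every bound `n` on the number of listed links there are `C > 0`, `p ≥ 0` such that for every `β ≥ 0`,
all masses, every torus `L ≥ 4`, every decidable set `c` of links LISTED by `r : ι → Edge` with
`|ι| ≤ n`, and every frozen exterior `U`, the weight `w = |det D| · e^{-βS}` restricted to the fibre
`W ↦ gl W = (c ? W : U)` satisfies `w (gl V) ≤ C (1+β)^p ∫ w (gl V') dHaar^⊗(V')` for every `V`.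
(Band limit + Haar small balls + untilt of the line `circle-transport`, assembled by the tilted
anti-concentration lemma, then one more untilt.) -/
theorem tilted_fibreDomination (Nf n : ℕ) :
    ∃ C p : ℝ, 0 < C ∧ 0 ≤ p ∧ ∀ β : ℝ, 0 ≤ β → ∀ (mq : Fin Nf → ℝ) (L : ℕ) [NeZero L], 4 ≤ L →
      ∀ (c : Edge 4 L → Prop) [DecidablePred c] (ι : Type) [Fintype ι] (r : ι → Edge 4 L),
        Fintype.card ι ≤ n → (∀ i, c (r i)) → (∀ e, c e → ∃ i, r i = e) →
      ∀ U V : GaugeConfig 4 L SU3,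
        ‖(diracMatrix (fun e => if c e then V e else U e : GaugeConfig 4 L SU3) mq).det‖ *
            Real.exp (-(β * wilsonAction (fundamentalRep (Fin 3))
              (fun e => if c e then V e else U e : GaugeConfig 4 L SU3))) ≤
          C * (1 + β) ^ p *
            ∫ V', ‖(diracMatrix (fun e => if c e then V' e else U e : GaugeConfig 4 L SU3) mq).det‖ *
              Real.exp (-(β * wilsonAction (fundamentalRep (Fin 3))
                (fun e => if c e then V' e else U e : GaugeConfig 4 L SU3)))
              ∂(Measure.pi fun _ : Edge 4 L => haarProbability SU3) := by
  obtain ⟨T, hT⟩ := ResolventCell.cellAverage_exists_diagCircle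
  have hW := CircleTransport.stub_eulerWord T hT
  obtain ⟨C_R, c₀, hCR, hc₀, hR⟩ := CircleTransport.stub_haarSmallBalls T hT hW
    (CircleTransport.stub_torusSmallBalls CircleTransport.stub_circleEngine.1
      CircleTransport.stub_circleEngine.2) (48 * Nf) n
  obtain ⟨K, -, hK⟩ := CircleTransport.stub_actionLipschitz T hT
  obtain ⟨C_D, p₀, hCD, hp₀, hD⟩ := ResolventCell.stub_untilt T hT n K
  refine ⟨2 * C_D * (2 * C_D * C_R + 1) ^ (1 / c₀), p₀ / c₀ + p₀, by positivity, by positivity, ?_⟩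
  intro β hβ mq L _ hL c _ ι _ r hcard hrc hcov U V
  -- the fibre data
  set gl : GaugeConfig 4 L SU3 → GaugeConfig 4 L SU3 := fun W e => if c e then W e else U e with hgl
  set Fd : GaugeConfig 4 L SU3 → ℝ := fun W => ‖(diracMatrix (gl W) mq).det‖ with hFd
  set S : GaugeConfig 4 L SU3 → ℝ := fun W => wilsonAction (fundamentalRep (Fin 3)) (gl W) with hS
  set wt : GaugeConfig 4 L SU3 → ℝ := fun W => Real.exp (-(β * S W)) with hwt
  set haar : Measure (GaugeConfig 4 L SU3) := Measure.pi fun _ : Edge 4 L => haarProbability SU3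
    with hhaar
  change Fd V * wt V ≤ _ * ∫ V', Fd V' * wt V' ∂haar
  have hglc : Continuous gl := by
    refine continuous_pi fun e => ?_
    by_cases h : c e
    · simp only [hgl, if_pos h]; exact continuous_apply e
    · simp only [hgl, if_neg h]; exact continuous_const
  have hFc : Continuous Fd := continuous_norm.comp ((continuous_det_diracMatrix mq).comp hglc)
  have hSc : Continuous S :=
    (continuous_wilsonAction_of_continuous _ (continuous_fundamentalRep (Fin 3))).comp hglc
  have hwtc : Continuous wt := Real.continuous_exp.comp ((continuous_const.mul hSc).neg)
  have hF0 : ∀ W, 0 ≤ Fd W := fun W => norm_nonneg _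
  have hwt0 : ∀ W, 0 ≤ wt W := fun W => (Real.exp_pos _).le
  haveI : IsProbabilityMeasure haar := by rw [hhaar]; infer_instance
  -- updating a listed link commutes with the glueing; dependence on the listed links only
  have hupd : ∀ e, c e → ∀ (W : GaugeConfig 4 L SU3) (h : SU3),
      gl (Function.update W e h) = Function.update (gl W) e h := by
    intro e he W h
    funext e'
    by_cases h' : e' = e
    · subst h'; simp only [hgl, Function.update_self, if_pos he]
    · simp only [hgl, Function.update_of_ne h']
  have hgldep : ∀ W W' : GaugeConfig 4 L SU3, (∀ i, W (r i) = W' (r i)) → gl W = gl W' := by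
    intro W W' h
    funext e
    by_cases he : c e
    · obtain ⟨i, rfl⟩ := hcov e he
      simp only [hgl, if_pos he, h i]
    · simp only [hgl, if_neg he]
  -- the ball-free untilt (density bound) on the fibre
  have hdens : ∀ W, wt W ≤ C_D * (1 + β) ^ p₀ * ∫ W', wt W' ∂haar := by
    refine hD (Edge 4 L) ι r hcard S hSc (fun W W' h => by simp only [hS, hgldep W W' h]) ?_ β hβ
    intro W i A B s s'
    simp only [hS, hupd _ (hrc i)]
    exact hK L hL (gl W) (r i) A B s s'
  -- relative Haar small balls on the fibre (band limit + Nikolskii/Remez)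
  have hR1 : ∀ W₀, 0 < Fd W₀ → ∀ ε : ℝ, 0 < ε →
      (haar {W | Fd W ≤ ε * Fd W₀}).toReal ≤ C_R * ε ^ c₀ := by
    refine hR (Edge 4 L) ι r hcard Fd hFc hF0 (fun W W' h => by simp only [hFd, hgldep W W' h]) ?_
    intro W i A B
    obtain ⟨a, ha⟩ := CircleTransport.stub_bandLimit T hT Nf mq L hL (gl W) (r i) A B
    refine ⟨a, fun t => ?_⟩
    simpa only [hFd, hupd _ (hrc i)] using ha t
  have hZ : 0 < ∫ W', wt W' ∂haar := ResolventCell.untilt_integral_pos (Edge 4 L) S hSc β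
  -- tilted anti-concentration, clause (a)
  obtain ⟨ha, -⟩ :=
    Literature.MeasureTheory.Integral.flatness_and_smallBalls_of_anticoncentration haar hFc hwtc hF0
      hwt0 (by positivity : 0 ≤ C_D * (1 + β) ^ p₀) hCR.le hc₀ hZ hdens hR1
  -- assembly
  have h1β : (1 : ℝ) ≤ 1 + β := by linarith
  set t : ℝ := (1 + β) ^ p₀ with ht
  have ht1 : 1 ≤ t := Real.one_le_rpow h1β hp₀
  have hIFw : 0 ≤ ∫ W', Fd W' * wt W' ∂haar := integral_nonneg fun W => mul_nonneg (hF0 W) (hwt0 W)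
  have hX : (2 * (C_D * t) * C_R + 1) ^ (1 / c₀) ≤ (2 * C_D * C_R + 1) ^ (1 / c₀) * (1 + β) ^ (p₀ / c₀) := by
    have hA : 2 * (C_D * t) * C_R + 1 ≤ (2 * C_D * C_R + 1) * t := by nlinarith [mul_pos hCD hCR]
    calc (2 * (C_D * t) * C_R + 1) ^ (1 / c₀) ≤ ((2 * C_D * C_R + 1) * t) ^ (1 / c₀) :=
          Real.rpow_le_rpow (by positivity) hA (by positivity)
      _ = (2 * C_D * C_R + 1) ^ (1 / c₀) * t ^ (1 / c₀) := Real.mul_rpow (by positivity) (by positivity)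
      _ = (2 * C_D * C_R + 1) ^ (1 / c₀) * (1 + β) ^ (p₀ / c₀) := by
          rw [ht, ← Real.rpow_mul (by linarith), mul_one_div]
  calc Fd V * wt V
      ≤ (2 * (2 * (C_D * t) * C_R + 1) ^ (1 / c₀) * ((∫ W', Fd W' * wt W' ∂haar) / ∫ W', wt W' ∂haar)) *
          (C_D * t * ∫ W', wt W' ∂haar) := mul_le_mul (ha V) (hdens V) (hwt0 V) (by positivity)
    _ = 2 * C_D * (2 * (C_D * t) * C_R + 1) ^ (1 / c₀) * t * ∫ W', Fd W' * wt W' ∂haar := by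
          field_simp
    _ ≤ 2 * C_D * ((2 * C_D * C_R + 1) ^ (1 / c₀) * (1 + β) ^ (p₀ / c₀)) * t *
          ∫ W', Fd W' * wt W' ∂haar := by gcongr
    _ = 2 * C_D * (2 * C_D * C_R + 1) ^ (1 / c₀) * (1 + β) ^ (p₀ / c₀ + p₀) *
          ∫ W', Fd W' * wt W' ∂haar := by
          rw [ht, Real.rpow_add (by linarith : (0 : ℝ) < 1 + β)]; ring

/-- **Stub T (`stub_tiltedCellAverage`) — the tested, tilted cell average.** For every flavour number
`N_f` and cell size `R` there are `C, p` such that for every `β ≥ 1`, bare masses `m_g ∈ [−2,2]`, torus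
side `L ≥ max 4 (2R+3)`, centre `x`, every continuous `g ≥ 0` whose product-Haar means over the CELL
FIBRE (links based in the cube `x + box 4 R` resampled, the rest frozen) are `≤ M` uniformly in the
frozen exterior, and every measurable `F ∈ [0,1]` that does not read the cell links:
`⟨F · g⟩₊ ≤ C (1+β^p) · M · ⟨F⟩₊` (`⟨·⟩₊ = qcdPhaseQuenchedExpect β L m_g`). -/
theorem stub_tiltedCellAverage :
    (∀ (Nf R : ℕ), ∃ C p : ℝ, 0 < C ∧ 0 ≤ p ∧ ∀ β : ℝ, 1 ≤ β → ∀ mq : Fin Nf → ℝ, (∀ g, -2 ≤ mq g ∧ mq g ≤ 2) →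
      ∀ (L : ℕ) [NeZero L], max 4 (2 * R + 3) ≤ L →
      ∀ (x : TorusSite 4 L) (g : GaugeConfig 4 L SU3 → ℝ), Continuous g → (∀ U, 0 ≤ g U) → ∀ M : ℝ,
        (∀ U : GaugeConfig 4 L SU3,
          ∫ V, g (fun e => if (∃ y ∈ box 4 R, e.1 = x + Torus.proj L y) then V e else U e)
            ∂(Measure.pi fun _ : Edge 4 L => haarProbability SU3) ≤ M) →
        ∀ F : GaugeConfig 4 L SU3 → ℝ, Measurable F → (∀ U, 0 ≤ F U ∧ F U ≤ 1) →
          (∀ U V : GaugeConfig 4 L SU3,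
            (∀ e : Edge 4 L, ¬ (∃ y ∈ box 4 R, e.1 = x + Torus.proj L y) → U e = V e) → F U = F V) →
          qcdPhaseQuenchedExpect β L mq (fun U => F U * g U) ≤ C * (1 + β ^ p) * M * qcdPhaseQuenchedExpect β L mq F) := by
  intro Nf R
  obtain ⟨C_T, p_T, hCT, hpT, hT⟩ := tilted_fibreDomination Nf (4 * (2 * R + 1) ^ 4)
  refine ⟨C_T * 2 ^ p_T, p_T, by positivity, hpT, ?_⟩
  intro β hβ mq _hmq L _ hL x g hg hg0 M hM F hFm hF01 hFloc
  have hβ0 : (0 : ℝ) ≤ β := by linarith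
  have hL4 : 4 ≤ L := le_trans (le_max_left _ _) hL
  have hρ : Continuous (fundamentalRep (Fin 3)) := continuous_fundamentalRep (Fin 3)
  have hSc : Continuous (wilsonAction (d := 4) (L := L) (G := SU3) (fundamentalRep (Fin 3))) :=
    continuous_wilsonAction_of_continuous _ hρ
  have hglc := ResolventCell.cellAverage_continuous_glue (L := L) fun e : Edge 4 L =>
    ∃ y ∈ box 4 R, e.1 = x + Torus.proj L y
  -- the tilted weight `w = |det D| e^{-βS}`
  set w : GaugeConfig 4 L SU3 → ℝ := fun U =>
    ‖(diracMatrix U mq).det‖ * Real.exp (-(β * wilsonAction (fundamentalRep (Fin 3)) U)) with hw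
  have hwc : Continuous w :=
    (continuous_det_diracMatrix mq).norm.mul ((continuous_const.mul hSc).neg.rexp)
  have hw0 : ∀ U, 0 ≤ w U := fun U => mul_nonneg (norm_nonneg _) (Real.exp_pos _).le
  -- the listed cell links and the fibrewise domination
  set r : ↥(box 4 R) × Fin 4 → Edge 4 L := fun q => (x + Torus.proj L (q.1 : Site 4), q.2) with hr
  have hrc : ∀ q : ↥(box 4 R) × Fin 4, ∃ y ∈ box 4 R, (r q).1 = x + Torus.proj L y :=
    fun q => ⟨q.1, q.1.2, rfl⟩
  have hcov : ∀ e : Edge 4 L, (∃ y ∈ box 4 R, e.1 = x + Torus.proj L y) → ∃ q, r q = e := by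
    rintro e ⟨y, hy, hye⟩
    exact ⟨(⟨y, hy⟩, e.2), Prod.ext hye.symm rfl⟩
  have hcard : Fintype.card (↥(box 4 R) × Fin 4) ≤ 4 * (2 * R + 1) ^ 4 := by
    rw [Fintype.card_prod, Fintype.card_coe, card_box, Fintype.card_fin, mul_comm]
  have hdom : ∀ U V : GaugeConfig 4 L SU3,
      w (fun e => if (∃ y ∈ box 4 R, e.1 = x + Torus.proj L y) then V e else U e) ≤
        C_T * (1 + β) ^ p_T * ∫ V', w (fun e => if (∃ y ∈ box 4 R, e.1 = x + Torus.proj L y)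
          then V' e else U e) ∂(Measure.pi fun _ : Edge 4 L => haarProbability SU3) :=
    fun U V => hT β hβ0 mq L hL4 (fun e : Edge 4 L => ∃ y ∈ box 4 R, e.1 = x + Torus.proj L y)
      (↥(box 4 R) × Fin 4) r hcard hrc hcov U V
  -- the test functional is constant on the fibres
  have hFgl : ∀ U V : GaugeConfig 4 L SU3,
      F (fun e => if (∃ y ∈ box 4 R, e.1 = x + Torus.proj L y) then V e else U e) = F U :=
    fun U V => hFloc _ U fun e he => by simp only [if_neg he]
  -- Step 0: `⟨φ⟩₊ = ∫ |det D| φ dμ_W / ∫ |det D| dμ_W`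
  rw [qcdPhaseQuenchedExpect_eq_div, qcdPhaseQuenchedExpect_eq_div, ← mul_div_assoc]
  refine div_le_div_of_nonneg_right ?_ (integral_nonneg fun _ => norm_nonneg _)
  -- Step 1: `∫ ψ dμ_W = ∫ ψ e^{-βS} dHaar / Z`, `Z > 0`
  have h1 := wilsonExpectation_eq_integral_div (d := 4) (L := L) (fundamentalRep (Fin 3)) hρ β
    (fun U => ‖(diracMatrix U mq).det‖ * (F U * g U))
  have h2 := wilsonExpectation_eq_integral_div (d := 4) (L := L) (fundamentalRep (Fin 3)) hρ β
    (fun U => ‖(diracMatrix U mq).det‖ * F U)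
  have hZ := integral_exp_neg_mul_wilsonAction_pos (d := 4) (L := L) (G := SU3)
    (fundamentalRep (Fin 3)) hρ β
  simp only [neg_mul] at h1 h2 hZ
  change wilsonExpectation (fundamentalRep (Fin 3)) β _ ≤
    _ * wilsonExpectation (fundamentalRep (Fin 3)) β _
  rw [h1, h2, ← mul_div_assoc]
  refine div_le_div_of_nonneg_right ?_ hZ.le
  -- Step 2: the tested abstract engine along the glueing
  have hM0 : 0 ≤ M := le_trans (integral_nonneg fun V => hg0 _) (hM 1)
  have key := tilted_abstract (Measure.pi fun _ : Edge 4 L => haarProbability SU3)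
    (fun U V : GaugeConfig 4 L SU3 =>
      (fun e => if (∃ y ∈ box 4 R, e.1 = x + Torus.proj L y) then V e else U e : GaugeConfig 4 L SU3))
    hglc (ResolventCell.stub_glueHaar (haarProbability SU3)
      {e : Edge 4 L | ∃ y ∈ box 4 R, e.1 = x + Torus.proj L y})
    w g F hwc hw0 hg hg0 hFm hF01 hFgl (A := C_T * (1 + β) ^ p_T) (M := M) (by positivity) hdom hM
  have e1 : (fun U => ‖(diracMatrix U mq).det‖ * (F U * g U) *
      Real.exp (-(β * wilsonAction (fundamentalRep (Fin 3)) U))) = fun U => F U * g U * w U := by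
    funext U; simp only [hw]; ring
  have e2 : (fun U => ‖(diracMatrix U mq).det‖ * F U *
      Real.exp (-(β * wilsonAction (fundamentalRep (Fin 3)) U))) = fun U => F U * w U := by
    funext U; simp only [hw]; ring
  rw [e1, e2]
  -- Step 3: `(1 + β)^{p_T} ≤ 2^{p_T} (1 + β^{p_T})`
  have hpow : C_T * (1 + β) ^ p_T ≤ C_T * 2 ^ p_T * (1 + β ^ p_T) := by
    rw [mul_assoc]
    exact mul_le_mul_of_nonneg_left (ResolventCell.cellAverage_one_add_rpow_le hβ hpT) hCT.le
  have hI0 : 0 ≤ ∫ U, F U * w U ∂(Measure.pi fun _ : Edge 4 L => haarProbability SU3) :=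
    integral_nonneg fun U => mul_nonneg (hF01 U).1 (hw0 U)
  exact key.trans (mul_le_mul_of_nonneg_right (mul_le_mul_of_nonneg_right hpow hM0) hI0)

end Summit.QuantumFields.QCD.Cruxes.ExtinctionBuildsQCD.DeterminantTilt

end
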